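import Mathlib.Analysis.SpecialFunctions.Complex.Log
import Mathlib.FieldTheory.IntermediateField.Adjoin.Basic
import Mathlib.RingTheory.AlgebraicIndependent.Transcendental
import Mathlib.LinearAlgebra.Quotient.Basic
import Literature.NumberTheory.Transcendental.ZilberField
import HarnessLib

/-!
# Named fact: Kirby's relative Schanuel theorem over `ecl(∅)` for `ℂ_exp`

Grounder file (D-0014 named facts) for the route `Schanuel/EclCore`, statement item
stmt-Schanuel-0068 (`kirby_relative_schanuel_complex`).

Kirby (Bull. LMS 42 (2010), Thm. 1.2): in any exponential field `F`, for an `ecl`-closed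
`C ⊆ F` and `x₁, …, xₙ ∈ F`,
`δ(x̄/C) := td(x̄, exp x̄ / C) − ldim_ℚ(x̄/C) ≥ dim(x̄/C) (≥ 0)`.
Specialised to `F = ℂ_exp`, `C = ecl(∅)` (`Literature.ecl ∅`, an exp-closed, hence `ecl`-closed, subfield
and `ℚ`-subspace) and to tuples that are `ℚ`-linearly independent modulo `C` (`ldim_ℚ(x̄/C) = n`):
the transcendence degree of `ℚ(C)(x̄, e^{x̄})` over `ℚ(C)` is at least `n`. The proof is Ax's
theorem (1971, Thm. 3) applied to exponential derivations. Consequence (Kirby 2010, discussion of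
Thm. 1.4): the essential counterexamples to Schanuel's conjecture lie in the countable field
`ecl(∅)`, so Schanuel's conjecture is equivalent to its restriction to tuples from `ecl(∅)` — that
equivalence is NOT recorded here (it needs the `GL_n(ℚ)` bookkeeping of the route's assembly).

Nothing is asserted; users take `(h : kirby_relative_schanuel_complex)`.

## References

* J. Kirby, *Exponential algebraicity in exponential fields*, Bull. London Math. Soc. 42 (2010),
  879–890, Thms. 1.1–1.4 (arXiv:0810.4285).
* J. Ax, *On Schanuel's conjectures*, Ann. of Math. 93 (1971), 252–268, Thm. 3.
-/

noncomputable section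

namespace Literature.NumberTheory.Transcendental

/-- NAMED FACT (Kirby 2010, Bull. LMS 42, Thm. 1.2 at `F = ℂ_exp`, `C = ecl(∅)`: "Suppose
`C ⊆ F` is `ecl^F`-closed. Let `x₁, …, xₙ ∈ F`. Then
`td(x̄, exp(x̄)/C) − ldim_ℚ(x̄/C) ≥ dim^F(x̄/C)`", the right side being `≥ 0`). If
`x : Fin n → ℂ` is `ℚ`-linearly independent modulo the `ℚ`-span of `ecl(∅)` (composition with
the quotient map `mkQ` is linearly independent), then
`n ≤ trdeg_{ℚ(ecl ∅)} ℚ(ecl ∅)(range x ∪ range (exp ∘ x))`. Users take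
`(h : kirby_relative_schanuel_complex)`. [cite: Kirby2010, Thm. 1.2] -/
def kirby_relative_schanuel_complex : Prop :=
  ∀ (n : ℕ) (x : Fin n → ℂ),
    LinearIndependent ℚ ((Submodule.span ℚ (ecl (∅ : Set ℂ))).mkQ ∘ x) →
      (n : Cardinal) ≤ Algebra.trdeg ↥(IntermediateField.adjoin ℚ (ecl (∅ : Set ℂ)))
        ↥(IntermediateField.adjoin ↥(IntermediateField.adjoin ℚ (ecl (∅ : Set ℂ)))
          (Set.range x ∪ Set.range (Complex.exp ∘ x)))

end Literature.NumberTheory.Transcendental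

end
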